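import Summits.BirchSwinnertonDyer.Rank1Residual.Additive.LocalTowerKernelCardEqTamagawa
import Literature.NumberTheory.EllipticCurves.Greenberg1999.LocalH1DivisibleCyclotomicProofs
import HarnessLib

/-!
# Brick B4 for the CYCLOTOMIC `ℤ_p`-extension, hypothesis-free: `#𝒦_{v,0}[p^∞] = p ^ ord_p c_v` at
# every `v ∤ p` (cell `b2b-bsdres`, CLASS-CLOSURE lane, class O10 — x1b GEN 35, class lead; file 54 of
# the series: B4, part 5 — no finite place splits completely in the cyclotomic tower)

HONEST FRAMING (cell `b2b-bsdres`, run/shared/lean/b2b/bsd-rank1-residual/, verbatim in every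
file): the goal of the cell is to DELETE the COMBINATION-SHAPED residual classes of the
Birch–Swinnerton-Dyer formula for ALL analytic-rank `≤ 1` elliptic curves over `ℚ` — "full BSD
formula for every rank `≤ 1` curve in class `C`" assembled STRICTLY from published theorems — so
that the rank-`≤ 1` remainder becomes exactly the CONSTRUCTION-SHAPED classes, which are TYPED
(missing-input `Prop`s), NOT attempted. This is not "finishing BSD". CLASS-CLOSURE lane: prove
what is provable now; shrink each hard class to its core with data; no claim beyond stated classes;
research routes on CONSTRUCTION-SHAPED X12 / O10; census / instrument output = EVIDENCE / conjecture
items, NEVER a Literature fact; `RESIDUAL-MAP.md` marks change only by signed lines. THIS FILE: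
ONE TOOL THEOREM (file 53 + the tree's `Greenberg1999.exists_apply_resGal_ne_one_of_isCyclotomic`) —
no definition, no named Literature fact, no Summits-side fact `def … : Prop`, no `sorry`, axioms
standard; nothing is booked; no label / mark / count / sub-cell moves; O10 stays OPEN /
CONSTRUCTION-SHAPED; nothing about `BSD(W, p)` of any pair is claimed.

## What (brick B4 of `B2-LOCALISATION-x1b.md` §3)

File 53 (`natCard_localTowerKerPrimary_zero_eq_pow_padicValNat_localTamagawaNumber`) gives
`#𝒦_{v,0}[p^∞] = p ^ ord_p c_v` at every `v ∤ p` that does not split completely in `K_∞/K`. For the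
CYCLOTOMIC `ℤ_p`-extension NO finite place splits completely — the tree's
`Greenberg1999.exists_apply_resGal_ne_one_of_isCyclotomic` ("`Gal((F_∞)_η/F_v) ≅ ℤ_p` for every
non-archimedean `v`", Greenberg LNM 1716 §1; Washington §13.1) — so the count holds at EVERY
`v ∤ p`, for every elliptic curve over a number field `K : Type` and every reduction type:
**`natCard_localTowerKerPrimary_zero_eq_pow_of_isCyclotomic`**. This is the form consumed by the
(C3_η) count at the bad primes `ℓ ≠ p` of the twist `W` (`#ker c_ℓ = c_ℓ(W)^{(p)}`, `K = ℚ`,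
`κ` cyclotomic).

References: [GreenbergLNM1716] R. Greenberg, LNM 1716 (1999), §1, §3 Lemma 3.3 (p. 88:
"`|ker(r_v)| = c_v^{(p)}`"); [Washington1997] §13.1.
-/

noncomputable section

open scoped Classical NNReal

open NumberField IsDedekindDomain Field

namespace Summit.BirchSwinnertonDyer.Rank1Residual.Additive

open Literature.NumberTheory.EllipticCurves Literature.NumberTheory.GaloisRepresentations
  IsDedekindDomain.HeightOneSpectrum WeierstrassCurve

/-- **`#𝒦_{v,0}[p^∞] = p ^ ord_p c_v` at EVERY `v ∤ p` for the cyclotomic `ℤ_p`-extension** (`E = W`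
elliptic over a number field `K`, any reduction type at `v`; `c_v` the local Tamagawa number of
`W/K_v`): file 53 with its non-splitting hypothesis discharged by the tree's
`Greenberg1999.exists_apply_resGal_ne_one_of_isCyclotomic`. Greenberg, LNM 1716, §3 p. 88:
"`|ker(r_v)| = c_v^{(p)}`". [cite: GreenbergLNM1716, §3 Lemma 3.3 (pp. 86–88)] [cite: Washington1997, §13.1] -/
theorem natCard_localTowerKerPrimary_zero_eq_pow_of_isCyclotomic {K : Type} [Field K] [NumberField K]
    (W : WeierstrassCurve K) [W.IsElliptic] {p : ℕ} [Fact p.Prime] {κ : ZpExtension K p}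
    (hκ : κ.IsCyclotomic) {v : HeightOneSpectrum (𝓞 K)} (hpv : (p : 𝓞 K) ∉ v.asIdeal) :
    Nat.card (W.localTowerKerPrimary κ (v.adicCompletion K) 0) =
      p ^ padicValNat p ((W.baseChange (v.adicCompletion K)).localTamagawaNumber
        (v.adicCompletionIntegers K)) := by
  obtain ⟨σ, hσ⟩ := Greenberg1999.exists_apply_resGal_ne_one_of_isCyclotomic hκ v
  exact natCard_localTowerKerPrimary_zero_eq_pow_padicValNat_localTamagawaNumber W κ hpv
    ⟨σ, fun h ↦ hσ (ZpExtension.mem_kerSubgroup.mp h)⟩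

end Summit.BirchSwinnertonDyer.Rank1Residual.Additive

end
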